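import Mathlib
import HarnessLib

/-!
# Crux `MobiusLadder.LiouvilleOrthogonalTC0` (stmt-QuantumAdvantage-1393), line `Sketch`, skeleton v6:
# stub `stub_levelOne` — Kane's level-one inequality from the Hoeffding tail

Stub `stub_levelOne` of the crux `LiouvilleOrthogonalTC0`, line `Sketch` (v6): D. M. Kane, *The average
sensitivity of an intersection of half spaces* (arXiv:1309.2987, STOC 2014), Lemma 6 — the
level-one inequality `E[S(x) Σ_i x_i] = O(p √(n log(1/p)))` — in crude counting form, derived from
the Hoeffding tail count on the cube (the neighbouring stub `stub_cubeTail`, which enters here only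
as the hypothesis `hTail`).

Write `x_j(σ) = +1` if `σ_j = o_j` and `-1` otherwise, and `T(σ) = Σ_j x_j(σ) ≤ m`. For a nonempty
`S ⊆ {0,1}^m` with `s = #S ≤ 2^m` and any `y ≥ 0`,

* (discretisation) `T(σ) ≤ y + #{u ∈ {0,…,m} : y + u ≤ T(σ)}` for every `σ`;
* (swap) `Σ_{σ∈S} #{u ≤ m : y + u ≤ T(σ)} ≤ Σ_{u=0}^{m} #{σ : y + u ≤ T(σ)}`;
* (tail) `#{σ : y + u ≤ T(σ)} ≤ 2^m e^{-(y+u)²/(2m)} ≤ 2^m e^{-y²/(2m)}`;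

so `Σ_{σ∈S} T(σ) ≤ s·y + (m+1)·2^m·e^{-y²/(2m)}`, and the choice `y = √(2m·log(2^m (m+1)/s))`
makes the last term equal to `s`, whence `Σ_{σ∈S} T(σ) ≤ s (y + 1) ≤ s (y + 2)`.
-/

set_option linter.dupNamespace false -- D-0017: single-problem summit ⇒ `QuantumAdvantage.QuantumAdvantage` by design

noncomputable section

namespace Summit.QuantumAdvantage.QuantumAdvantage.Theorems.LiouvilleOrthogonalTC0

open Finset

namespace StubLevelOne

/-- Each signed coordinate is at most `1`, so `T(σ) = Σ_j x_j(σ) ≤ m`. -/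
theorem sum_sign_le (m : ℕ) (o σ : Fin m → Bool) :
    ∑ j : Fin m, (if σ j = o j then (1 : ℝ) else -1) ≤ m := by
  calc ∑ j : Fin m, (if σ j = o j then (1 : ℝ) else -1) ≤ ∑ _j : Fin m, (1 : ℝ) :=
        Finset.sum_le_sum fun j _ => by split_ifs <;> norm_num
    _ = m := by simp

/-- Pointwise discretisation: if `T ≤ m` and `y ≥ 0` then `T ≤ y + #{u ∈ {0,…,m} : y + u ≤ T}`
(when `T > y` the count is at least `⌊T - y⌋₊ + 1 > T - y`). -/
theorem le_add_card_filter {m : ℕ} {T y : ℝ} (hT : T ≤ m) (hy : 0 ≤ y) :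
    T ≤ y + (((range (m + 1)).filter fun u : ℕ => y + u ≤ T).card : ℝ) := by
  by_cases h : T ≤ y
  · have h0 : (0 : ℝ) ≤ (((range (m + 1)).filter fun u : ℕ => y + u ≤ T).card : ℝ) := by
      positivity
    linarith
  · have h' : y < T := not_le.mp h
    have hd : 0 ≤ T - y := by linarith
    have hk1 : ((⌊T - y⌋₊ : ℕ) : ℝ) ≤ T - y := Nat.floor_le hd
    have hk2 : T - y < ((⌊T - y⌋₊ : ℕ) : ℝ) + 1 := Nat.lt_floor_add_one (T - y)
    have hsub : range (⌊T - y⌋₊ + 1) ⊆ (range (m + 1)).filter fun u : ℕ => y + u ≤ T := by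
      intro u hu
      rw [Finset.mem_range] at hu
      have hu1 : u ≤ ⌊T - y⌋₊ := by omega
      have hu' : (u : ℝ) ≤ ⌊T - y⌋₊ := by exact_mod_cast hu1
      rw [Finset.mem_filter, Finset.mem_range]
      refine ⟨?_, by linarith⟩
      have hum : (u : ℝ) ≤ m := by linarith
      have hum' : u ≤ m := by exact_mod_cast hum
      omega
    have hcard := Finset.card_le_card hsub
    rw [Finset.card_range] at hcard
    have hcard' : ((⌊T - y⌋₊ : ℕ) : ℝ) + 1
        ≤ (((range (m + 1)).filter fun u : ℕ => y + u ≤ T).card : ℝ) := by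
      exact_mod_cast hcard
    linarith

/-- Summing the discretised counts over `S ⊆ univ` and swapping the order of summation:
`Σ_{σ∈S} #{u < n : y + u ≤ T σ} ≤ Σ_{u<n} #{σ : y + u ≤ T σ}`. -/
theorem sum_card_filter_le {α : Type*} [Fintype α] (S : Finset α) (T : α → ℝ) (y : ℝ) (n : ℕ) :
    ∑ σ ∈ S, (((range n).filter fun u : ℕ => y + u ≤ T σ).card : ℝ)
      ≤ ∑ u ∈ range n, (((univ : Finset α).filter fun σ => y + u ≤ T σ).card : ℝ) := by
  calc ∑ σ ∈ S, (((range n).filter fun u : ℕ => y + u ≤ T σ).card : ℝ)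
      ≤ ∑ σ, (((range n).filter fun u : ℕ => y + u ≤ T σ).card : ℝ) :=
        Finset.sum_le_sum_of_subset_of_nonneg (Finset.subset_univ S) fun _ _ _ => by positivity
    _ = ∑ σ, ∑ u ∈ range n, (if y + u ≤ T σ then (1 : ℝ) else 0) := by
        simp only [Finset.natCast_card_filter]
    _ = ∑ u ∈ range n, ∑ σ, (if y + u ≤ T σ then (1 : ℝ) else 0) := Finset.sum_comm
    _ = ∑ u ∈ range n, (((univ : Finset α).filter fun σ => y + u ≤ T σ).card : ℝ) := by
        simp only [Finset.natCast_card_filter]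

/-- **Kane's Lemma 6, abstract counting form.** If `T ≤ m` pointwise on a finite type (`m ≥ 1`),
`#{σ : t ≤ T σ} ≤ 2^m e^{-t²/(2m)}` for all `t ≥ 0`, and `S` is nonempty with `#S ≤ 2^m`, then
`Σ_{σ∈S} T σ ≤ #S · (√(2m log(2^m (m+1)/#S)) + 2)`. -/
theorem levelOne_of_tail {α : Type*} [Fintype α] (m : ℕ) (hm : 1 ≤ m) (T : α → ℝ)
    (hTle : ∀ σ, T σ ≤ m)
    (hTail : ∀ t : ℝ, 0 ≤ t →
      (((univ : Finset α).filter fun σ => t ≤ T σ).card : ℝ)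
        ≤ 2 ^ m * Real.exp (-(t ^ 2 / (2 * m))))
    (S : Finset α) (hS : S.Nonempty) (hS2 : (S.card : ℝ) ≤ 2 ^ m) :
    ∑ σ ∈ S, T σ ≤ S.card * (Real.sqrt (2 * m * Real.log (2 ^ m * (m + 1) / S.card)) + 2) := by
  have hs0 : (0 : ℝ) < S.card := Nat.cast_pos.mpr hS.card_pos
  have hm0 : (0 : ℝ) < m := by exact_mod_cast hm
  have hX : (2 : ℝ) ^ m * ((m : ℝ) + 1) ≠ 0 := by positivity
  have harg_pos : (0 : ℝ) < 2 ^ m * (m + 1) / S.card := by positivity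
  have harg_ge : (1 : ℝ) ≤ 2 ^ m * (m + 1) / S.card := by
    rw [le_div_iff₀ hs0, one_mul]
    calc (S.card : ℝ) ≤ 2 ^ m := hS2
      _ = 2 ^ m * 1 := (mul_one _).symm
      _ ≤ 2 ^ m * (m + 1) := by gcongr; linarith
  set L : ℝ := Real.log (2 ^ m * (m + 1) / S.card) with hL
  have hL0 : 0 ≤ L := Real.log_nonneg harg_ge
  set y : ℝ := Real.sqrt (2 * m * L) with hy
  have hy0 : 0 ≤ y := Real.sqrt_nonneg _
  have hy2 : y ^ 2 = 2 * m * L := Real.sq_sqrt (by positivity)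
  have hyL : y ^ 2 / (2 * m) = L := by
    rw [hy2]
    exact mul_div_cancel_left₀ L (by positivity)
  have hexp : Real.exp (-(y ^ 2 / (2 * m))) = S.card / (2 ^ m * (m + 1)) := by
    rw [hyL, Real.exp_neg, hL, Real.exp_log harg_pos, inv_div]
  -- Step 1: pointwise discretisation, summed over `S`.
  have step1 : ∑ σ ∈ S, T σ
      ≤ ∑ σ ∈ S, (y + (((range (m + 1)).filter fun u : ℕ => y + u ≤ T σ).card : ℝ)) :=
    Finset.sum_le_sum fun σ _ => le_add_card_filter (hTle σ) hy0
  -- Step 3: the tail bound for each shift `u`, weakened to the shift-free exponent.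
  have step3 : ∀ u ∈ range (m + 1),
      (((univ : Finset α).filter fun σ => y + u ≤ T σ).card : ℝ)
        ≤ 2 ^ m * Real.exp (-(y ^ 2 / (2 * m))) := by
    intro u _
    have hu0 : (0 : ℝ) ≤ u := Nat.cast_nonneg u
    calc (((univ : Finset α).filter fun σ => y + u ≤ T σ).card : ℝ)
        ≤ 2 ^ m * Real.exp (-((y + u) ^ 2 / (2 * m))) := hTail (y + u) (by positivity)
      _ ≤ 2 ^ m * Real.exp (-(y ^ 2 / (2 * m))) := by
        apply mul_le_mul_of_nonneg_left _ (by positivity)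
        apply Real.exp_le_exp.mpr
        have h1 : y ^ 2 ≤ (y + u) ^ 2 := by nlinarith
        have h2 : y ^ 2 / (2 * m) ≤ (y + u) ^ 2 / (2 * m) :=
          div_le_div_of_nonneg_right h1 (by positivity)
        linarith
  -- The choice of `y` makes the summed tail equal to `#S`.
  have hsum : ∑ _u ∈ range (m + 1), (2 : ℝ) ^ m * Real.exp (-(y ^ 2 / (2 * m))) = S.card := by
    rw [Finset.sum_const, Finset.card_range, nsmul_eq_mul, hexp]
    push_cast
    rw [← mul_assoc, mul_comm ((m : ℝ) + 1) (2 ^ m)]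
    exact mul_div_cancel₀ _ hX
  calc ∑ σ ∈ S, T σ
      ≤ ∑ σ ∈ S, (y + (((range (m + 1)).filter fun u : ℕ => y + u ≤ T σ).card : ℝ)) := step1
    _ = S.card * y + ∑ σ ∈ S, (((range (m + 1)).filter fun u : ℕ => y + u ≤ T σ).card : ℝ) := by
        rw [Finset.sum_add_distrib, Finset.sum_const, nsmul_eq_mul]
    _ ≤ S.card * y + ∑ u ∈ range (m + 1),
          (((univ : Finset α).filter fun σ => y + u ≤ T σ).card : ℝ) := by
        have h3 := sum_card_filter_le S T y (m + 1)
        linarith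
    _ ≤ S.card * y + ∑ _u ∈ range (m + 1), (2 : ℝ) ^ m * Real.exp (-(y ^ 2 / (2 * m))) := by
        have h4 := Finset.sum_le_sum step3
        linarith
    _ = S.card * (y + 1) := by rw [hsum]; ring
    _ ≤ S.card * (y + 2) := mul_le_mul_of_nonneg_left (by linarith) hs0.le

end StubLevelOne

open StubLevelOne in
/-- **Stub `stub_levelOne` (line `Sketch`, v6) — Kane's Lemma 6 (the level-one inequality) from the
tail bound.** For a nonempty `S ⊆ {0,1}^m` of size `s` and any orientation `o`,
`Σ_{σ∈S} Σ_j x_j(σ) ≤ s (√(2m log(2^m (m+1)/s)) + 2)`, where `x_j(σ) = ±1` according as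
`σ_j = o_j` or not: with `T = Σ_j x_j ≤ m` and `y = √(2m log(2^m(m+1)/s))`,
`Σ_{σ∈S} T ≤ s y + Σ_{u=0}^{m} #{σ : y + u ≤ T} ≤ s y + (m+1) 2^m e^{-y²/(2m)} = s (y + 1)`
(D. M. Kane, arXiv:1309.2987, Lemma 6, counting form). -/
theorem stub_levelOne (m : ℕ) (hm : 1 ≤ m)
    (hTail : ∀ (o : Fin m → Bool) (t : ℝ), 0 ≤ t →
      (((univ : Finset (Fin m → Bool)).filter fun σ =>
          t ≤ ∑ j : Fin m, (if σ j = o j then (1 : ℝ) else -1)).card : ℝ)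
        ≤ 2 ^ m * Real.exp (-(t ^ 2 / (2 * m))))
    (o : Fin m → Bool) (S : Finset (Fin m → Bool)) (hS : S.Nonempty) :
    ∑ σ ∈ S, ∑ j : Fin m, (if σ j = o j then (1 : ℝ) else -1)
      ≤ S.card * (Real.sqrt (2 * m * Real.log (2 ^ m * (m + 1) / S.card)) + 2) := by
  have hS2 : (S.card : ℝ) ≤ 2 ^ m := by
    have h := Finset.card_le_univ S
    rw [Fintype.card_fun, Fintype.card_bool, Fintype.card_fin] at h
    exact_mod_cast h
  refine levelOne_of_tail m hm
    (fun σ : Fin m → Bool => ∑ j : Fin m, (if σ j = o j then (1 : ℝ) else -1)) ?_ ?_ S hS hS2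
  · intro σ
    exact sum_sign_le m o σ
  · intro t ht
    exact hTail o t ht

end Summit.QuantumAdvantage.QuantumAdvantage.Theorems.LiouvilleOrthogonalTC0

end
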